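import Summits.KontsevichZagierPeriods.KontsevichZagierPeriods.Theses.LiftingCriteria
import Literature.NumberTheory.Transcendental.KZSubcalculusInvariants
import Literature.NumberTheory.Transcendental.KZProductIdeal
import Literature.NumberTheory.Transcendental.SemialgebraicMapsProofs

/-!
# `PellVertexRelation` (stmt-KontsevichZagierPeriods-3577, route LiftingCriteria, support)

The `K ≠ ℚ` boundary example of the lifting route, proved unconditionally. For the
`ℚ`-semialgebraic Nash function `g(z) = (4 − 3z)/(2√(2 − z))` on `[0,1]` (the derivative of
`z√(2 − z)`):

1. the dilation function is `v_g(ϖ) = ∫_{[0,1]} g(ϖ z) dz = √(2 − ϖ)` for `ϖ ∈ (0,1]`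
   (`dilation_integral`: transfer to `ℝ` along `MeasurableEquiv.funUnique`, then the fundamental
   theorem of calculus with primitive `y ↦ y√(2 − ϖy)`);
2. for Pell solutions `t² = 2s² − 1`, `s > 0`, the vertex relation `s·v_g(1/s²) − t = 0` is NOT the
   specialisation of a polynomial relation `l₁(ϖ)√(2 − ϖ) + l₀(ϖ) = 0` on `[0,1]` with
   `l₁(1/s²) = s` (`not_exists_polynomial_relation`: squaring gives the polynomial identity
   `l₁²(2 − X) = l₀²` on the infinite set `[0,1]`, hence everywhere; at `x > 2` the two sides have
   opposite signs, so `l₁` vanishes on `(2, ∞)`, i.e. `l₁ = 0`, contradicting `l₁(1/s²) = s > 0`);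
3. and yet `s·[fibre at 1/s²] − t·[1] ∈ KZ.relations` (`zsmul_of_sub_zsmul_of_mem_relations`): ONE
   Newton–Leibniz move along the (only) coordinate of `[0,1]¹` with primitive
   `F(z) = z√(2 − z/s²)`, `F(1) − F(0) = √(2 − 1/s²) = t/s`, gives `[r] − [pt, t/s]`; integer
   scaling is integrand additivity (`KZ.IntegralRep.of_constMul_nat_sub_nsmul_mem_relations`):
   `s•[pt, t/s] ≡ [pt, t] ≡ t•[pt, 1]`.

The closing theorem is `Summit.KontsevichZagierPeriods.LiftingCriteria.pellVertexRelation_proof`.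

References: Y. André, *G-functions and geometry* (1989), Ch. VII §5 (local-to-global lifting needs
`K = ℚ`-rationality); M. Kontsevich, D. Zagier, *Periods* (2001), §1.2 rule (3).
-/

noncomputable section

open MeasureTheory Set
open Literature.NumberTheory.Transcendental Literature.NumberTheory.Transcendental.KZ


namespace Summit.KontsevichZagierPeriods.LiftingCriteria

namespace PellVertexRelation

/-- The primitive `y ↦ y√(2 − κy)` has derivative `(4 − 3κτ)/(2√(2 − κτ))` at every `τ` with
`κτ < 2`; with `κ = ϖ` this is the dilated integrand `g(ϖy)`, `g(z) = (4 − 3z)/(2√(2 − z))`, and with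
`κ = 1/s²` it is the fibre integrand at the vertex parameter `1/s²`. [folklore] -/
theorem hasDerivAt_mul_sqrt (κ τ : ℝ) (h : κ * τ < 2) :
    HasDerivAt (fun y : ℝ => y * Real.sqrt (2 - κ * y))
      ((4 - 3 * (κ * τ)) / (2 * Real.sqrt (2 - κ * τ))) τ := by
  have h0 : 0 < 2 - κ * τ := by linarith
  have hS : 0 < Real.sqrt (2 - κ * τ) := Real.sqrt_pos.mpr h0
  have h1 : HasDerivAt (fun y : ℝ => 2 - κ * y) (-κ) τ := by
    simpa using ((hasDerivAt_id τ).const_mul κ).const_sub 2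
  have h2 : HasDerivAt (fun y : ℝ => Real.sqrt (2 - κ * y)) (-κ / (2 * Real.sqrt (2 - κ * τ))) τ :=
    h1.sqrt h0.ne'
  have h3 : HasDerivAt (fun y : ℝ => y * Real.sqrt (2 - κ * y))
      (1 * Real.sqrt (2 - κ * τ) + τ * (-κ / (2 * Real.sqrt (2 - κ * τ)))) τ :=
    (hasDerivAt_id' τ).mul h2
  have hval : 1 * Real.sqrt (2 - κ * τ) + τ * (-κ / (2 * Real.sqrt (2 - κ * τ))) =
      (4 - 3 * (κ * τ)) / (2 * Real.sqrt (2 - κ * τ)) := by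
    have hSS : Real.sqrt (2 - κ * τ) ^ 2 = 2 - κ * τ := Real.sq_sqrt h0.le
    have hne : (2:ℝ) * Real.sqrt (2 - κ * τ) ≠ 0 := mul_ne_zero two_ne_zero hS.ne'
    rw [one_mul, eq_div_iff hne, add_mul, mul_assoc, div_mul_cancel₀ _ hne]
    linear_combination 2 * hSS
  rw [hval] at h3
  exact h3

/-- **The dilation function of `g` is `√(2 − ϖ)`.** For `ϖ ∈ (0,1]`,
`∫_{[0,1]¹} g(ϖ z) dz = √(2 − ϖ)` where `g(z) = (4 − 3z)/(2√(2 − z))`: transfer the integral over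
`[0,1]¹ ⊆ ℝ¹` to `[0,1] ⊆ ℝ` (`MeasurableEquiv.funUnique`, volume preserving) and apply the
fundamental theorem of calculus to the primitive `y ↦ y√(2 − ϖy)`. [folklore] -/
theorem dilation_integral (ϖ : ℝ) (hϖ : ϖ ∈ Set.Ioc (0:ℝ) 1) :
    (∫ z in Set.pi Set.univ (fun _ : Fin 1 => Set.Icc (0:ℝ) 1),
      (fun z : Fin 1 → ℝ => (4 - 3 * z 0) / (2 * Real.sqrt (2 - z 0))) (ϖ • z)) =
      Real.sqrt (2 - ϖ) := by
  have hmp : MeasurePreserving (MeasurableEquiv.funUnique (Fin 1) ℝ) volume volume :=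
    volume_preserving_funUnique (Fin 1) ℝ
  have hset : Set.pi Set.univ (fun _ : Fin 1 => Set.Icc (0:ℝ) 1) =
      (MeasurableEquiv.funUnique (Fin 1) ℝ) ⁻¹' Set.Icc 0 1 := by
    ext z
    simp only [Set.mem_univ_pi, Fin.forall_fin_one, Set.mem_preimage]
    simp [MeasurableEquiv.funUnique, Fin.default_eq_zero]
  have key : (∫ z in Set.pi Set.univ (fun _ : Fin 1 => Set.Icc (0:ℝ) 1),
      (fun z : Fin 1 → ℝ => (4 - 3 * z 0) / (2 * Real.sqrt (2 - z 0))) (ϖ • z)) =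
      ∫ y in Set.Icc (0:ℝ) 1, (4 - 3 * (ϖ * y)) / (2 * Real.sqrt (2 - ϖ * y)) := by
    rw [hset, ← hmp.setIntegral_preimage_emb (MeasurableEquiv.funUnique (Fin 1) ℝ).measurableEmbedding
      (fun y : ℝ => (4 - 3 * (ϖ * y)) / (2 * Real.sqrt (2 - ϖ * y))) (Set.Icc 0 1)]
    rfl
  rw [key, integral_Icc_eq_integral_Ioc, ← intervalIntegral.integral_of_le zero_le_one]
  have hprod : ∀ y ∈ Set.Icc (0:ℝ) 1, ϖ * y < 2 := by
    intro y hy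
    nlinarith [hϖ.1, hϖ.2, hy.1, hy.2, mul_nonneg hϖ.1.le (sub_nonneg.mpr hy.2)]
  rw [intervalIntegral.integral_eq_sub_of_hasDerivAt (f := fun y : ℝ => y * Real.sqrt (2 - ϖ * y))]
  · simp
  · intro y hy
    rw [Set.uIcc_of_le zero_le_one] at hy
    exact hasDerivAt_mul_sqrt ϖ y (hprod y hy)
  · apply ContinuousOn.intervalIntegrable
    rw [Set.uIcc_of_le zero_le_one]
    apply ContinuousOn.div
    · exact Continuous.continuousOn (by fun_prop)
    · exact Continuous.continuousOn (by fun_prop)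
    · intro y hy
      have : 0 < 2 - ϖ * y := by linarith [hprod y hy]
      positivity

/-- **The vertex relation is not the specialisation of a polynomial relation.** For `s > 0` there
are no real polynomials `l₁`, `l₀` with `l₁(1/s²) = s`, `l₀(1/s²) = −t` and
`l₁(ϖ)√(2 − ϖ) + l₀(ϖ) = 0` on `[0,1]`: squaring, `l₁²·(2 − X) − l₀²` vanishes on the infinite set
`[0,1]`, hence is the zero polynomial; at any `x > 2` the identity `l₁(x)²(2 − x) = l₀(x)²` has a
non-positive left and a non-negative right side, so `l₁(x) = 0`; thus `l₁` has infinitely many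
roots, `l₁ = 0`, contradicting `l₁(1/s²) = s > 0`. (In André's language: the degree-one relation
`s·v_g(1/s²) − t = 0` among the values of `(1, v_g)`, `v_g = √(2 − ϖ)`, is non-trivial.)
[folklore] -/
theorem not_exists_polynomial_relation (s t : ℕ) (hs : 0 < s) :
    ¬ ∃ (l₁ l₀ : Polynomial ℝ), l₁.eval (((s : ℝ) ^ 2)⁻¹) = s ∧ l₀.eval (((s : ℝ) ^ 2)⁻¹) = -(t : ℝ) ∧
      ∀ ϖ ∈ Set.Icc (0:ℝ) 1, l₁.eval ϖ * Real.sqrt (2 - ϖ) + l₀.eval ϖ = 0 := by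
  rintro ⟨l₁, l₀, h₁, -, h⟩
  -- `P := l₁² (2 − X) − l₀²` vanishes on `[0,1]`, hence is zero
  set P : Polynomial ℝ := l₁ ^ 2 * (Polynomial.C 2 - Polynomial.X) - l₀ ^ 2 with hP
  have hPeval : ∀ x : ℝ, P.eval x = (l₁.eval x) ^ 2 * (2 - x) - (l₀.eval x) ^ 2 := by
    intro x
    simp [hP]
  have hP0 : P = 0 := by
    apply Polynomial.eq_zero_of_infinite_isRoot
    refine Set.Infinite.mono ?_ (Set.Icc_infinite (zero_lt_one' ℝ))
    intro ϖ hϖ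
    have hl₀ : l₀.eval ϖ = -(l₁.eval ϖ * Real.sqrt (2 - ϖ)) := by linarith [h ϖ hϖ]
    have h2 : (0:ℝ) ≤ 2 - ϖ := by linarith [hϖ.2]
    have hsq : Real.sqrt (2 - ϖ) ^ 2 = 2 - ϖ := Real.sq_sqrt h2
    show P.eval ϖ = 0
    rw [hPeval, hl₀]
    linear_combination (-(l₁.eval ϖ) ^ 2) * hsq
  -- at `x > 2` the identity forces `l₁ x = 0`
  have hroots : ∀ x : ℝ, 2 < x → l₁.eval x = 0 := by
    intro x hx
    have h0 : P.eval x = 0 := by rw [hP0, Polynomial.eval_zero]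
    rw [hPeval] at h0
    have h3 : (l₁.eval x) ^ 2 * (x - 2) = 0 := by
      apply le_antisymm
      · nlinarith [sq_nonneg (l₀.eval x)]
      · exact mul_nonneg (sq_nonneg _) (by linarith)
    rcases mul_eq_zero.mp h3 with h4 | h4
    · exact (pow_eq_zero_iff two_ne_zero).mp h4
    · exact absurd h4 (by linarith)
  have hl₁ : l₁ = 0 :=
    Polynomial.eq_zero_of_infinite_isRoot _
      (Set.Infinite.mono (fun x hx => hroots x hx) (Set.Ioi_infinite (2:ℝ)))
  rw [hl₁, Polynomial.eval_zero] at h₁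
  have : (0:ℝ) < s := by exact_mod_cast hs
  linarith

/-- **The vertex relation is ONE Newton–Leibniz move plus bookkeeping.** For a Pell solution
`t² = 2s² − 1`, `s > 0`, the representation `r = [[0,1]¹, g(z/s²)]` (fibre of the dilation family at
`1/s²`) and the unit representation `u = [pt, 1]` satisfy `s•[r] − t•[u] ∈ KZ.relations`: the
Newton–Leibniz move `KZ.newtonLeibnizRel` (base `ℝ⁰`, bounds `0 ≤ 1`, primitive
`F(z) = z√(2 − z/s²)`, `F(1) − F(0) = √(2 − 1/s²) = t/s`) gives `[r] − [pt, t/s]`, and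
`s•[pt, t/s] ≡ [pt, s·(t/s)] = [pt, t·1] ≡ t•[pt, 1]` by integrand additivity
(`KZ.IntegralRep.of_constMul_nat_sub_nsmul_mem_relations`).
[Kontsevich–Zagier 2001, §1.2 rules (1), (3)] -/
theorem zsmul_of_sub_zsmul_of_mem_relations (s t : ℕ) (hs : 0 < s)
    (hpell : (t : ℤ) ^ 2 = 2 * (s : ℤ) ^ 2 - 1) (r : IntegralRep 1) (u : IntegralRep 0)
    (hr : r.domain = Set.pi Set.univ (fun _ : Fin 1 => Set.Icc (0:ℝ) 1))
    (hri : ∀ z ∈ Set.pi Set.univ (fun _ : Fin 1 => Set.Icc (0:ℝ) 1), r.integrand z =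
      (fun z : Fin 1 → ℝ => (4 - 3 * z 0) / (2 * Real.sqrt (2 - z 0))) ((((s : ℝ) ^ 2)⁻¹) • z))
    (hu : u.domain = Set.univ) (hui : ∀ x, u.integrand x = 1) :
    (s : ℤ) • of r - (t : ℤ) • of u ∈ relations := by
  -- the constants
  have hs0 : (0:ℝ) < s := by exact_mod_cast hs
  have hsR : (s:ℝ) ≠ 0 := hs0.ne'
  set κ : ℝ := ((s:ℝ) ^ 2)⁻¹ with hκ
  have hκ1 : κ ≤ 1 := by
    have h1 : (1:ℝ) ≤ s := by exact_mod_cast hs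
    exact inv_le_one_of_one_le₀ (by nlinarith)
  have hpellR : (t:ℝ) ^ 2 = 2 * (s:ℝ) ^ 2 - 1 := by
    have h := congrArg (Int.cast : ℤ → ℝ) hpell
    push_cast at h
    exact h
  have hsqrt : Real.sqrt (2 - κ) = (t:ℝ) / s := by
    have h2 : 2 - κ = ((t:ℝ) / s) ^ 2 := by
      rw [div_pow, hpellR, hκ]
      field_simp
    rw [h2, Real.sqrt_sq (by positivity)]
  have halg : IsAlgebraic ℚ ((t:ℝ) / s) := by
    simpa using isAlgebraic_algebraMap (R := ℚ) (A := ℝ) ((t:ℚ) / s)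
  -- the constant representation `[pt, t/s]`
  set c : IntegralRep 0 := u.constMul ((t:ℝ) / s) halg with hc
  -- Step 1: one Newton–Leibniz move, `[r] − [pt, t/s] ∈ relations`
  have hNL : of r - of c ∈ relations := by
    apply newtonLeibnizRel_subset_relations
    have hF : IsSemialgebraicFunOn ℚ r.domain
        (fun z : Fin 1 → ℝ => z 0 * Real.sqrt (2 - κ * z 0)) := by
      have hX : IsSemialgebraicFunOn ℚ r.domain (fun z : Fin 1 → ℝ => z 0) := by
        simpa using isSemialgebraicFunOn_aeval (R := ℝ) r.isSemialgebraic_domain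
          (MvPolynomial.X 0 : MvPolynomial (Fin 1) ℚ)
      have hL : IsSemialgebraicFunOn ℚ r.domain (fun z : Fin 1 → ℝ => 2 - κ * z 0) := by
        have h := isSemialgebraicFunOn_aeval (R := ℝ) r.isSemialgebraic_domain
          (MvPolynomial.C 2 - MvPolynomial.C (((s:ℚ) ^ 2)⁻¹) * MvPolynomial.X 0 :
            MvPolynomial (Fin 1) ℚ)
        refine h.congr fun z _ => ?_
        simp [hκ]
      exact IsSemialgebraicFunOn.mul_holds hX (IsSemialgebraicFunOn.sqrt_holds hL)
    have h0 : IsSemialgebraicFunOn ℚ c.domain (fun _ : Fin 0 → ℝ => (0:ℝ)) := by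
      simpa using isSemialgebraicFunOn_aeval (R := ℝ) c.isSemialgebraic_domain
        (0 : MvPolynomial (Fin 0) ℚ)
    have h1 : IsSemialgebraicFunOn ℚ c.domain (fun _ : Fin 0 → ℝ => (1:ℝ)) := by
      simpa using isSemialgebraicFunOn_aeval (R := ℝ) c.isSemialgebraic_domain
        (1 : MvPolynomial (Fin 0) ℚ)
    have hcd : c.domain = Set.univ := by rw [hc, IntegralRep.domain_constMul, hu]
    refine ⟨0, r, c, fun _ => 0, fun _ => 1, fun z => z 0 * Real.sqrt (2 - κ * z 0),
      hF, h0, h1, fun _ _ => zero_le_one, ?_, ?_, ?_, ?_, rfl⟩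
    · rw [hr, hcd]
      ext z
      simp only [Set.mem_univ_pi, Fin.forall_fin_one, Set.mem_Icc, Set.mem_setOf_eq, Set.mem_univ,
        true_and, Fin.last_zero]
    · intro x _
      exact HasDerivAt.continuousOn fun τ hτ =>
        hasDerivAt_mul_sqrt κ τ (by nlinarith [hτ.1, hτ.2, Set.mem_Icc.mp hτ])
    · intro x _ τ hτ
      have hmem : (Fin.snoc x τ : Fin 1 → ℝ) ∈ Set.pi Set.univ (fun _ : Fin 1 => Set.Icc (0:ℝ) 1) := by
        simp only [Set.mem_univ_pi, Fin.forall_fin_one, Fin.snoc_zero, Set.mem_Icc]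
        exact ⟨hτ.1.le, hτ.2.le⟩
      rw [hri _ hmem]
      simp only [Fin.snoc_zero, Pi.smul_apply, smul_eq_mul]
      exact hasDerivAt_mul_sqrt κ τ (by nlinarith [hτ.1, hτ.2])
    · intro x _
      simp [hc, hui, Fin.snoc_zero, hsqrt]
  -- Step 2: integer scaling is integrand additivity
  have h1 : (s : ℕ) • of c - of (c.constMul ((s : ℕ) : ℝ) (isAlgebraic_nat s)) ∈ relations := by
    rw [← neg_sub]
    exact relations.neg_mem (c.of_constMul_nat_sub_nsmul_mem_relations s)
  have h2 := u.of_constMul_nat_sub_nsmul_mem_relations t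
  have heq : c.constMul ((s : ℕ) : ℝ) (isAlgebraic_nat s) = u.constMul ((t : ℕ) : ℝ) (isAlgebraic_nat t) := by
    refine IntegralRep.ext' rfl ?_
    funext x
    simp only [IntegralRep.integrand_constMul, hc]
    field_simp
  have key : (s : ℤ) • of r - (t : ℤ) • of u =
      (s : ℕ) • (of r - of c) + ((s : ℕ) • of c - of (c.constMul ((s : ℕ) : ℝ) (isAlgebraic_nat s))) +
        (of (u.constMul ((t : ℕ) : ℝ) (isAlgebraic_nat t)) - (t : ℕ) • of u) := by
    rw [heq, natCast_zsmul, natCast_zsmul, smul_sub]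
    abel
  rw [key]
  exact relations.add_mem (relations.add_mem (relations.nsmul_mem hNL s) h1) h2

end PellVertexRelation

/-- **`PellVertexRelation` holds** (item stmt-KontsevichZagierPeriods-3577 of route
LiftingCriteria): the dilation function of `g(z) = (4 − 3z)/(2√(2 − z))` is `√(2 − ϖ)`; for Pell
solutions `t² = 2s² − 1` the vertex relation `s·v_g(1/s²) = t` is not the specialisation of a
polynomial relation among `(1, v_g)`, yet `s·[fibre at 1/s²] − t·[1]` is a relation of the
Kontsevich–Zagier calculus (one Newton–Leibniz move). [folklore] -/
theorem pellVertexRelation_proof :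
    Summit.KontsevichZagierPeriods.KontsevichZagierPeriods.Theses.LiftingCriteria.PellVertexRelation := by
  unfold Summit.KontsevichZagierPeriods.KontsevichZagierPeriods.Theses.LiftingCriteria.PellVertexRelation
  refine ⟨fun ϖ hϖ => PellVertexRelation.dilation_integral ϖ hϖ, fun s t hs hpell => ⟨?_, ?_⟩⟩
  · exact PellVertexRelation.not_exists_polynomial_relation s t hs
  · intro r u hr hri hu hui
    exact PellVertexRelation.zsmul_of_sub_zsmul_of_mem_relations s t hs hpell r u hr hri hu hui

end Summit.KontsevichZagierPeriods.LiftingCriteria
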